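import Literature.MathematicalPhysics.QuantumFieldTheory.Federbush1986.LandauModePlaquetteVariables

/-!
# `Federbush1986.LandauPenaltyFibre` — [Federbush1986PhaseCellI] §3 p. 327–328: the penalised action (3.4), the operator
# «D = −Δ + α²Σ_γ χ_γχ_γ» (3.5), «the Fourier transform of C = D⁻¹» (3.6) with M (3.7), and «From (3.4) we see the
# minimizing A′ will satisfy A′ = α²C Σ_γ β_γχ_γ (3.11)» — TYPED WITH BODIES; (3.6) PROVED as the exact two-sided inverse
# of (3.5) on every momentum fibre (Woodbury identity), (3.4) ⇒ (3.11) PROVED (Euler–Lagrange), (3.11) → (3.12) as α → ∞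

statement-level skeleton of published theorems with citation tags; proofs where landed; nothing here is a claim about the Yang–Mills mass gap

CITATION HEADER.  P. Federbush, *A phase cell approach to Yang–Mills theory. I. Modes, lattice-continuum duality*, Commun.
Math. Phys. **107** (1986) 319–329 [Federbush1986PhaseCellI], §3 «The Potential A_μ(x) of a Single Excitation», p. 327–328,
displays (3.4)–(3.7), (3.11)–(3.12); P. Federbush, C. Williamson, *II*, J. Math. Phys. **28** (1987) 1416–1419
[FederbushWilliamson1987PhaseCellII], (2.1).  Row F1.Eq3.2-3.12 of `run/shared/lean/pub/lit-balaban/lit-balaban-r17/SKELETON-r17.md`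
(the member «(3.4)–(3.6)∕(3.11) as operators» named in that row's cell, r17 g57).

WHAT PRINT SAYS (p. 327–328, re-read first-hand on the page images).  «We seek a minimum of the action S, for a Landau gauge A′,
a gauge transformation of A.  S = ½∫Σ_{i,j}(∂A′_i/∂x_j)² + ½α² Σ_{p∈ℒ⁰} ((χ_p, A′) − β_p)², (3.4) and then take the limit α → ∞.
(Alternatively one could use Lagrange multipliers.)  We let D be the differential-integral operator D = −Δ + α² Σ_γ χ_γχ_γ. (3.5)
The sum over γ is understood to be over plaquettes in ℒ⁰.  We now exhibit the Fourier transform of C = D⁻¹,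
C(p, p′) = (1/p²) δ(p − p′) − Σ_n (2π)⁴ (1/p²) P̃(p) [α²/(1 + α²M(p))] P̃̄(p′) (1/p′²) δ(p − p′ − 2πn), (3.6)
M = M_ab = Σ_n (2π)⁴ P̄̃_a(p + 2πn) (1/(p + 2πn)²) P̃_b(p + 2πn). (3.7) … From (3.4) we see the minimizing A′ will satisfy
A′ = α²C Σ_γ β_γχ_γ. (3.11)  Taking the limit α → ∞ we find in terms of Fourier transforms, A′_i(p) = Σ_{γ,a} (1/p²) P̃_{i,a}(p)
(ε + M(p))⁻¹_{a,γ} β_γ e^{−iŷ·p}. (3.12)»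

WHAT IS TYPED AND PROVED HERE.
* Position space, verbatim: `LandauPenalty.penaltyAction` = (3.4) and `LandauPenalty.opDPos` = (3.5) acting on a vector field
  `A : ℝ⁴ → ℝ⁴` (`(χ_p, A)` = the tree's `plaqFunctional 0 A p`, `χ_γ` = `plaqTestField γ`).
* The momentum fibre.  The kernel (3.6) couples `p` only to `p′ = p − 2πn`: every display of §3 after (3.5) lives on ONE fibre
  `{p + 2πn : n ∈ ℤ⁴}` of a momentum `p` (real, off `2πℤ⁴`, where the series (3.7) converges — `gramM`).  On the fibre carrier
  `PlaquetteGram.Fib = (ℤ⁴ → ℂ⁴)` we type WITH BODIES: `lam p n = |p + 2πn|²` (the symbol of `−Δ`), `Ptil a q = P̃_a(q)` of (3.10)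
  (`(1/2π)² · fourierFactor`, as in `LandauModeFormula`), the pairing `pairing p a f = (2π)⁴ Σ_n P̄̃_a(p+2πn)·f(n)` (the fibre of
  `A ↦ Σ_b e^{−ip·b}(χ_{⟨b,a⟩}, A)`: Plancherel and Poisson summation over the plaquette corners `b ∈ ℤ⁴`, cf.
  `fourier_plaqTestField_level0`: `χ̂_{⟨b,a⟩}(k) = e^{−ik·b} P̃_a(k)`), **(3.5)** `opD α p f = lam·f + α² Σ_a P̃_a ⟨a, f⟩`,
  **(3.6)** `opC α p` = the printed kernel applied along the fibre with `kMat α p = α²(1 + α²M(p))⁻¹`, **(3.4)** `penS α p β̂ f =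
  ½ Σ_n |p+2πn|²|f(n)|² + ½ α²(2π)⁻⁴ Σ_a |⟨a, f⟩ − β̂_a|²` (the fibre density of (3.4): Plancherel for the first term, Parseval over
  `b ∈ ℤ⁴` for the second, `β̂_a(p) = Σ_b e^{−ip·b} β_{⟨b,a⟩}`), and the source of (3.11) `src p β̂ = Σ_a β̂_a P̃_a(p + 2πn)`.
* PROVED: `pairing_Ptil_div_lam` — the matrix `V*Λ⁻¹V` of the rank-six perturbation IS (3.7) (`= gramM p a b`, every real `p`);
  `isUnit_one_add_gramM` — `1 + α²M(p)` is invertible (M ≥ 0 Hermitian, `gramM_posSemidef`); **`opD_opC` / `opC_opD` — (3.6) is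
  the two-sided inverse of (3.5) on the fibre** («C = D⁻¹»; the Woodbury identity `(Λ + α²VV*)⁻¹ = Λ⁻¹ − Λ⁻¹V α²(1 + α²V*Λ⁻¹V)⁻¹
  V*Λ⁻¹`), for every `α`, every real `p` off `2πℤ⁴`, on all fibre functions for which the six pairings converge; **`opC_src` —
  (3.11) computed through (3.6)**: `α² C src = (1/|p+2πn|²) Σ_a P̃_a(p+2πn) [α²(1 + α²M(p))⁻¹β̂]_a`, whose base-point value
  (`opC_src_zero`) is print's finite-α form of (3.12) and tends, for the unit bond, to [F-II] (2.1) `Aprime` as `α → ∞`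
  (`tendsto_opC_src_unitBond`, = the tree's `tendsto_landau312_unitBond_alpha`); **`opD_eq_src_of_isMin` / `eq_opC_src_of_isMin`
  — «From (3.4) we see the minimizing A′ will satisfy (3.11)»**: a minimiser of `penS` against every one-site perturbation
  satisfies `D f = α² src`, hence `f = α² C src`.

HONEST SCOPE.  (a) The identification of the position-space objects `penaltyAction` / `opDPos` with their fibre forms `penS` /
`opD` (Plancherel on `L²(ℝ⁴; ℝ⁴)` plus Poisson summation over `b ∈ ℤ⁴`, i.e. `S = ∫_{cell} penS_p dp` and `(DA)^~|_{fibre p} =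
opD (Ã|_{fibre p})`) is the dictionary stated above and is NOT proved in this file; everything proved is a statement on one fibre.
(b) «minimizing» is rendered as minimality against one-site perturbations of the fibre function (which is all the Euler–Lagrange
equation uses); existence of a minimiser is not asserted (for (3.11) none is needed: `opC_src` is an identity).  (c) Real momenta
off `2πℤ⁴` throughout (as in `LandauModeFormula`); `M(p) = M(p + 2πn)` (`gramM_shiftR`) is why (3.6) may write `M(p)`.
No `Prop`-valued definition, no named fact (D-0026); axioms standard.

ERRATUM (v1.1, r17 gen 58, 2026-08-23; doc-only — every declaration below is unchanged).  Two located defects of the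
position-space bodies of this file were found while proving the dictionary (member M′, `LandauPenaltyDictionary`, p363958):
(E1, precedence) `LandauPenalty.penaltyAction α β A := (1/2) * ∫ x, Σ_{i,j}(pd A j i x)² + (1/2) * α² * Σ'_q (…)²` PARSES with the
penalty sum INSIDE the `d⁴x` integral (Lean's `∫ x, …` binds weaker than `+`): kernel record `LandauPenalty.penaltyAction_eq` (`rfl`)
in `LandauPenaltyDictionary`; for a smooth compactly supported `A`, `α ≠ 0` and a non-zero penalty the integrand is a non-integrable
constant offset on `ℝ⁴` and `penaltyAction α β A = 0` (`penaltyAction_eq_zero_of_ne_zero`) — so `penaltyAction` is NOT print's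
`S` except at zero penalty (`penaltyAction_nonneg` stays true but is not about `S`).  (E2, orientation) `penaltyAction` and `opDPos`
sum over the TYPE `Plaq 0`, which carries BOTH orientations `⟨b,i,j⟩`, `⟨b,j,i⟩` of every plaquette (and the degenerate `⟨b,i,i⟩`,
contributing `0`), whereas print sums over `p ∈ ℒ⁰` with ONE fixed orientation ((3.9) «We have taken an arbitrary fixed orientation
of the axes»): `opDPos α = opDPosFix (√2·α)` (`LandauPenaltyDictionary`: `opDPos_eq_two_mul`, `opDPos_eq_opDPosFix`) and
`Σ_{q : Plaq 0}((χ_q, A) − β_q)² = 2 Σ_{(b,a)}(…)²` (`tsum_penalty_eq_two_mul`) — immaterial under print's `α → ∞`.  The VERBATIM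
(3.4)/(3.5) position-space bodies are `LandauPenalty.penaltyActionFix` / `opDPosFix` of `LandauPenaltyDictionary`, where the dictionary
of HONEST SCOPE (a) is PROVED for them on the core `C_c^∞(ℝ⁴; ℝ⁴)` (D1 `pairing_fib_eq_sum`, D2 `fib_opDPosFix`, D3
`penaltyActionFix_eq_integral_penS`, D4 `opC_fib_opDPosFix`).  Every FIBRE statement of this file (`penS`, `opD`, `opC`, `opD_opC`,
`opC_opD`, `opC_src`, `opD_eq_src_of_isMin`, …) is unaffected: `∑'`/`∑` bind tighter than `+`, and the fibre index `Fin 6` is one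
orientation per plaquette.  (Def bodies are append-only; the two names are kept, with this record.)
-/

namespace Literature.MathematicalPhysics.QuantumFieldTheory.Federbush1986

noncomputable section

open Complex ModeAnalyticity Filter Topology
open scoped BigOperators ComplexConjugate Matrix

namespace PlaquetteGram

open ModeDecay (toC)

/-- Carrier of one momentum fibre `{p + 2πn : n ∈ ℤ⁴}`: `ℂ⁴`-valued functions of `n ∈ ℤ⁴` (the values `Ã(p + 2πn)` of a
transformed vector field along the fibre; the `δ(p − p′ − 2πn)` of (3.6) couples exactly these). [cite: Federbush1986PhaseCellI, (3.6) p. 327] -/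
abbrev Fib : Type := (Fin 4 → ℤ) → Fin 4 → ℂ

/-- `P̃_a(q)_μ` of (3.10) in print's Fourier convention: `(1/2π)² · fourierFactor a q μ` (as in `LandauModeFormula`).
[cite: Federbush1986PhaseCellI, (3.10) p. 328] -/
def Ptil (a : Fin 6) (q : Fin 4 → ℝ) (μ : Fin 4) : ℂ :=
  (1 / (2 * Real.pi) ^ 2 : ℂ) * fourierFactor (axisPair a).1 (axisPair a).2 q μ

/-- `|p + 2πn|²` — the symbol of `−Δ` of (3.5) on the fibre. [cite: Federbush1986PhaseCellI, (3.5) p. 327] -/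
def lam (p : Fin 4 → ℝ) (n : Fin 4 → ℤ) : ℂ := csq (toC (shiftR p n))

/-- `Σ_k (p_k + 2πn_k)²` as a real number. [cite: Federbush1986PhaseCellI, (3.5) p. 327] -/
def lamR (p : Fin 4 → ℝ) (n : Fin 4 → ℤ) : ℝ := ∑ k, shiftR p n k ^ 2

/-- `|p + 2πn|²` is the real number `Σ_k (p_k + 2πn_k)²`. [cite: Federbush1986PhaseCellI, (3.5) p. 327] -/
theorem lam_eq (p : Fin 4 → ℝ) (n : Fin 4 → ℤ) : lam p n = (lamR p n : ℂ) := by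
  unfold lam lamR csq
  push_cast
  rfl

/-- `|p + 2πn|² > 0` off `2πℤ⁴`. [cite: Federbush1986PhaseCellI, (3.6) p. 327] -/
theorem lamR_pos {p : Fin 4 → ℝ} (hp : ∀ k (m : ℤ), p k ≠ 2 * Real.pi * m) (n : Fin 4 → ℤ) : 0 < lamR p n := by
  unfold lamR
  have h0 : shiftR p n 0 ≠ 0 := shiftR_ne_zero (hp 0) n
  exact lt_of_lt_of_le (by positivity : (0 : ℝ) < shiftR p n 0 ^ 2)
    (Finset.single_le_sum (fun k _ => sq_nonneg (shiftR p n k)) (Finset.mem_univ 0))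

/-- [cite: Federbush1986PhaseCellI, (3.6) p. 327] -/
theorem lam_ne_zero {p : Fin 4 → ℝ} (hp : ∀ k (m : ℤ), p k ≠ 2 * Real.pi * m) (n : Fin 4 → ℤ) : lam p n ≠ 0 := by
  rw [lam_eq]; exact_mod_cast (lamR_pos hp n).ne'

/-- [folklore] -/
private theorem shiftR_zero (p : Fin 4 → ℝ) : shiftR p 0 = p := by
  funext k; simp [shiftR]

/-- The fibre pairing `⟨a, f⟩ = (2π)⁴ Σ_n Σ_μ P̄̃_a(p+2πn)_μ f(n)_μ` — the fibre of `A ↦ Σ_b e^{−ip·b} (χ_{⟨b,a⟩}, A)` (the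
`χ_γ(χ_γ, ·)` of (3.5) summed over the corners `b` of the plaquettes `γ = ⟨b, a⟩` with axis pair `a`; `tsum`, value `0` off
summability). [cite: Federbush1986PhaseCellI, (3.5) p. 327, (3.3) p. 327] -/
def pairing (p : Fin 4 → ℝ) (a : Fin 6) (f : Fib) : ℂ :=
  (2 * Real.pi : ℂ) ^ 4 * ∑' n, ∑ μ, conj (Ptil a (shiftR p n) μ) * f n μ

/-- **(3.5) «D = −Δ + α² Σ_γ χ_γχ_γ» on the fibre**: `(Df)(n) = |p+2πn|² f(n) + α² Σ_a P̃_a(p+2πn) ⟨a, f⟩`.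
[cite: Federbush1986PhaseCellI, (3.5) p. 327] -/
def opD (α : ℝ) (p : Fin 4 → ℝ) (f : Fib) : Fib := fun n μ =>
  lam p n * f n μ + (α : ℂ) ^ 2 * ∑ a, Ptil a (shiftR p n) μ * pairing p a f

/-- The `6 × 6` matrix `α²/(1 + α²M(p))` of (3.6) (`M` = `gramM`, (3.7)). [cite: Federbush1986PhaseCellI, (3.6)–(3.7) p. 327] -/
def kMat (α : ℝ) (p : Fin 4 → ℝ) : Matrix (Fin 6) (Fin 6) ℂ :=
  ((α : ℂ) ^ 2) • (1 + ((α : ℂ) ^ 2) • gramM p)⁻¹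

/-- **(3.6) «C(p, p′) = (1/p²)δ(p − p′) − Σ_n (2π)⁴ (1/p²) P̃(p) [α²/(1 + α²M(p))] P̃̄(p′) (1/p′²) δ(p − p′ − 2πn)»** applied
along the fibre: `(Cg)(n) = g(n)/|p+2πn|² − (1/|p+2πn|²) Σ_{a,b} P̃_a(p+2πn) [α²(1+α²M(p))⁻¹]_{ab} (2π)⁴ Σ_{n′} P̄̃_b(p+2πn′)·g(n′)/|p+2πn′|²`.
[cite: Federbush1986PhaseCellI, (3.6) p. 327] -/
def opC (α : ℝ) (p : Fin 4 → ℝ) (g : Fib) : Fib := fun n μ =>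
  g n μ / lam p n - (1 / lam p n) *
    ∑ a, ∑ b, Ptil a (shiftR p n) μ * kMat α p a b * pairing p b (fun n' ν => g n' ν / lam p n')

/-- [folklore] -/
private theorem conj_invTwoPiSq : conj (1 / (2 * Real.pi) ^ 2 : ℂ) = (1 / (2 * Real.pi) ^ 2 : ℂ) := by
  have : (1 / (2 * Real.pi) ^ 2 : ℂ) = ((1 / (2 * Real.pi) ^ 2 : ℝ) : ℂ) := by push_cast; rfl
  rw [this, Complex.conj_ofReal]

/-- [folklore] -/
private theorem twoPi_ne_zero : (2 * Real.pi : ℂ) ≠ 0 := by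
  exact_mod_cast (by positivity : (2 * Real.pi : ℝ) ≠ 0)

/-- The `n`-th term of `⟨a, P̃_b/|·|²⟩` is `(2π)⁻⁴` times the `n`-th term of (3.7). [cite: Federbush1986PhaseCellI, (3.7) p. 327] -/
theorem Ptil_term_eq (p : Fin 4 → ℝ) (a b : Fin 6) (n : Fin 4 → ℤ) :
    ∑ μ, conj (Ptil a (shiftR p n) μ) * (Ptil b (shiftR p n) μ / lam p n)
      = (1 / (2 * Real.pi) ^ 4 : ℂ) * ∑ μ, conj (fourierFactor (axisPair a).1 (axisPair a).2 (shiftR p n) μ) *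
          fourierFactor (axisPair b).1 (axisPair b).2 (shiftR p n) μ / csq (toC (shiftR p n)) := by
  unfold Ptil lam
  rw [Finset.mul_sum]
  refine Finset.sum_congr rfl fun μ _ => ?_
  rw [map_mul, conj_invTwoPiSq]
  have hπ := twoPi_ne_zero
  field_simp

/-- **The Gram matrix of the rank-six perturbation is (3.7)**: `⟨a, P̃_b(p+2π·)/|p+2π·|²⟩ = M_ab(p)` (unconditional).
[cite: Federbush1986PhaseCellI, (3.7) p. 327] -/
theorem pairing_Ptil_div_lam (p : Fin 4 → ℝ) (a b : Fin 6) :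
    pairing p a (fun n ν => Ptil b (shiftR p n) ν / lam p n) = gramM p a b := by
  unfold pairing
  simp_rw [Ptil_term_eq]
  rw [tsum_mul_left, ← mul_assoc]
  have hπ := twoPi_ne_zero
  have h1 : (2 * Real.pi : ℂ) ^ 4 * (1 / (2 * Real.pi) ^ 4 : ℂ) = 1 := by field_simp
  rw [h1, one_mul]
  rfl

/-- Summability of that series at a real momentum off `2πℤ⁴` (`summable_gramM_term`). [cite: Federbush1986PhaseCellI, (3.7) p. 327] -/
theorem summable_Ptil_term {p : Fin 4 → ℝ} (hp : ∀ k (m : ℤ), p k ≠ 2 * Real.pi * m) (a b : Fin 6) :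
    Summable fun n : Fin 4 → ℤ => ∑ μ, conj (Ptil a (shiftR p n) μ) * (Ptil b (shiftR p n) μ / lam p n) := by
  simp_rw [Ptil_term_eq]
  exact (summable_gramM_term hp a b).mul_left _

/-- `1 + α²M(p)` is invertible (`M(p)` positive semidefinite Hermitian, `gramM_posSemidef`). [cite: Federbush1986PhaseCellI, (3.6) p. 327] -/
theorem isUnit_one_add_gramM {p : Fin 4 → ℝ} (hp : ∀ k (m : ℤ), p k ≠ 2 * Real.pi * m) (α : ℝ) :
    IsUnit ((1 : Matrix (Fin 6) (Fin 6) ℂ) + ((α : ℂ) ^ 2) • gramM p) := by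
  by_cases hα : α = 0
  · subst hα
    simp
  · have hε : (0 : ℝ) < (α ^ 2)⁻¹ := inv_pos.mpr (by positivity)
    have hαC : ((α : ℂ) ^ 2) ≠ 0 := pow_ne_zero _ (ofReal_ne_zero.mpr hα)
    set R := gramM p + (((α ^ 2)⁻¹ : ℝ) : ℂ) • (1 : Matrix (Fin 6) (Fin 6) ℂ) with hR
    have hRu : IsUnit R := isUnit_resolvent (gramM_posSemidef hp) hε
    have hRinj : Function.Injective R.mulVec := Matrix.mulVec_injective_iff_isUnit.mpr hRu
    have hBR : (1 : Matrix (Fin 6) (Fin 6) ℂ) + ((α : ℂ) ^ 2) • gramM p = ((α : ℂ) ^ 2) • R := by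
      rw [hR, smul_add, smul_smul]
      push_cast
      rw [mul_inv_cancel₀ hαC, one_smul, add_comm]
    rw [hBR, ← Matrix.mulVec_injective_iff_isUnit]
    intro y₁ y₂ h
    apply hRinj
    have : ((α : ℂ) ^ 2) • (R *ᵥ y₁) = ((α : ℂ) ^ 2) • (R *ᵥ y₂) := by
      rw [← Matrix.smul_mulVec, ← Matrix.smul_mulVec]; exact h
    exact smul_right_injective _ hαC this

/-- [cite: Federbush1986PhaseCellI, (3.6) p. 327] -/
theorem isUnit_det_one_add_gramM {p : Fin 4 → ℝ} (hp : ∀ k (m : ℤ), p k ≠ 2 * Real.pi * m) (α : ℝ) :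
    IsUnit ((1 : Matrix (Fin 6) (Fin 6) ℂ) + ((α : ℂ) ^ 2) • gramM p).det :=
  (Matrix.isUnit_iff_isUnit_det _).mp (isUnit_one_add_gramM hp α)

/-- `(1 + α²M) · α²(1 + α²M)⁻¹ = α²`. [cite: Federbush1986PhaseCellI, (3.6) p. 327] -/
theorem one_add_mul_kMat {p : Fin 4 → ℝ} (hp : ∀ k (m : ℤ), p k ≠ 2 * Real.pi * m) (α : ℝ) :
    ((1 : Matrix (Fin 6) (Fin 6) ℂ) + ((α : ℂ) ^ 2) • gramM p) * kMat α p = ((α : ℂ) ^ 2) • (1 : Matrix _ _ ℂ) := by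
  unfold kMat
  rw [Matrix.mul_smul, Matrix.mul_nonsing_inv _ (isUnit_det_one_add_gramM hp α)]

/-- `α²(1 + α²M)⁻¹ · (1 + α²M) = α²`. [cite: Federbush1986PhaseCellI, (3.6) p. 327] -/
theorem kMat_mul_one_add {p : Fin 4 → ℝ} (hp : ∀ k (m : ℤ), p k ≠ 2 * Real.pi * m) (α : ℝ) :
    kMat α p * ((1 : Matrix (Fin 6) (Fin 6) ℂ) + ((α : ℂ) ^ 2) • gramM p) = ((α : ℂ) ^ 2) • (1 : Matrix _ _ ℂ) := by
  unfold kMat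
  rw [Matrix.smul_mul, Matrix.nonsing_inv_mul _ (isUnit_det_one_add_gramM hp α)]

/-- `Kc + α²M(Kc) = α²c` for `K = α²(1 + α²M)⁻¹`. [cite: Federbush1986PhaseCellI, (3.6) p. 327] -/
theorem kMat_mulVec_add {p : Fin 4 → ℝ} (hp : ∀ k (m : ℤ), p k ≠ 2 * Real.pi * m) (α : ℝ) (c : Fin 6 → ℂ) :
    kMat α p *ᵥ c + ((α : ℂ) ^ 2) • (gramM p *ᵥ (kMat α p *ᵥ c)) = ((α : ℂ) ^ 2) • c := by
  have h := congrArg (fun A : Matrix (Fin 6) (Fin 6) ℂ => A *ᵥ c) (one_add_mul_kMat hp α)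
  simp only [Matrix.add_mul, Matrix.one_mul, Matrix.smul_mul, Matrix.add_mulVec, Matrix.smul_mulVec,
    Matrix.one_mulVec, ← Matrix.mulVec_mulVec] at h
  exact h

/-- `Kd + α²K(Md) = α²d` for `K = α²(1 + α²M)⁻¹`. [cite: Federbush1986PhaseCellI, (3.6) p. 327] -/
theorem kMat_mulVec_add' {p : Fin 4 → ℝ} (hp : ∀ k (m : ℤ), p k ≠ 2 * Real.pi * m) (α : ℝ) (d : Fin 6 → ℂ) :
    kMat α p *ᵥ d + ((α : ℂ) ^ 2) • (kMat α p *ᵥ (gramM p *ᵥ d)) = ((α : ℂ) ^ 2) • d := by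
  have h := congrArg (fun A : Matrix (Fin 6) (Fin 6) ℂ => A *ᵥ d) (kMat_mul_one_add hp α)
  simp only [Matrix.mul_add, Matrix.mul_one, Matrix.mul_smul, Matrix.add_mulVec, Matrix.smul_mulVec,
    Matrix.one_mulVec, ← Matrix.mulVec_mulVec] at h
  exact h


/-! ## Woodbury: `C = D⁻¹` on the fibre -/

/-- The six pairings `⟨b, g/|p+2π·|²⟩` of `Λ⁻¹g` (the vector `P̃̄(p′)(1/p′²)`-part of (3.6) applied to `g`). [cite: Federbush1986PhaseCellI, (3.6) p. 327] -/
def cvec (p : Fin 4 → ℝ) (g : Fib) : Fin 6 → ℂ := fun b => pairing p b (fun n ν => g n ν / lam p n)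

/-- The six pairings `⟨a, f⟩` (the `χ_γ(χ_γ, ·)`-part of (3.5) applied to `f`). [cite: Federbush1986PhaseCellI, (3.5) p. 327] -/
def dvec (p : Fin 4 → ℝ) (f : Fib) : Fin 6 → ℂ := fun a => pairing p a f

/-- Bookkeeping: `Σ_{a,b} P̃_a K_{ab} c_b = Σ_a P̃_a (Kc)_a`. [cite: Federbush1986PhaseCellI, (3.6) p. 327] -/
theorem sum_sum_Ptil_kMat (α : ℝ) (p : Fin 4 → ℝ) (q : Fin 4 → ℝ) (μ : Fin 4) (c : Fin 6 → ℂ) :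
    ∑ a, ∑ b, Ptil a q μ * kMat α p a b * c b = ∑ a, Ptil a q μ * (kMat α p *ᵥ c) a := by
  refine Finset.sum_congr rfl fun a _ => ?_
  rw [Matrix.mulVec, dotProduct, Finset.mul_sum]
  exact Finset.sum_congr rfl fun b _ => by ring

/-- (3.6) applied, in matrix form: `(Cg)(n) = g(n)/|p+2πn|² − (1/|p+2πn|²) Σ_a P̃_a(p+2πn) (K⟨·, g/|·|²⟩)_a`. [cite: Federbush1986PhaseCellI, (3.6) p. 327] -/
theorem opC_apply (α : ℝ) (p : Fin 4 → ℝ) (g : Fib) (n : Fin 4 → ℤ) (μ : Fin 4) :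
    opC α p g n μ = g n μ / lam p n - (1 / lam p n) * ∑ a, Ptil a (shiftR p n) μ * (kMat α p *ᵥ cvec p g) a := by
  simp only [opC, sum_sum_Ptil_kMat]
  rfl

/-- The pairings of `Cg`: `⟨a, Cg⟩ = c_a − (MKc)_a` with `c = ⟨·, g/|·|²⟩`. [cite: Federbush1986PhaseCellI, (3.6)–(3.7) p. 327] -/
theorem pairing_opC {p : Fin 4 → ℝ} (hp : ∀ k (m : ℤ), p k ≠ 2 * Real.pi * m) (α : ℝ) (g : Fib)
    (hg : ∀ b, Summable fun n : Fin 4 → ℤ => ∑ ν, conj (Ptil b (shiftR p n) ν) * (g n ν / lam p n)) (a : Fin 6) :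
    pairing p a (opC α p g) = cvec p g a - (gramM p *ᵥ (kMat α p *ᵥ cvec p g)) a := by
  -- the summand, split into the `Λ⁻¹ g` part and the finite-rank part
  have hsplit : ∀ n : Fin 4 → ℤ, ∑ μ, conj (Ptil a (shiftR p n) μ) * opC α p g n μ
      = ∑ μ, conj (Ptil a (shiftR p n) μ) * (g n μ / lam p n)
        - ∑ a', (kMat α p *ᵥ cvec p g) a' * ∑ μ, conj (Ptil a (shiftR p n) μ) * (Ptil a' (shiftR p n) μ / lam p n) := by
    intro n
    simp_rw [opC_apply, mul_sub, Finset.sum_sub_distrib]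
    congr 1
    simp_rw [Finset.mul_sum]
    rw [Finset.sum_comm]
    refine Finset.sum_congr rfl fun a' _ => Finset.sum_congr rfl fun μ _ => ?_
    ring
  unfold pairing
  simp_rw [hsplit]
  rw [Summable.tsum_sub (hg a) (summable_sum fun a' _ => (summable_Ptil_term hp a a').mul_left _)]
  rw [Summable.tsum_finsetSum fun a' _ => (summable_Ptil_term hp a a').mul_left _]
  simp_rw [tsum_mul_left]
  rw [mul_sub, Finset.mul_sum]
  congr 1
  rw [Matrix.mulVec, dotProduct]
  refine Finset.sum_congr rfl fun a' _ => ?_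
  rw [← pairing_Ptil_div_lam p a a', pairing]
  ring

/-- **«C = D⁻¹» (3.6), right inverse: `D(Cg) = g`** on the fibre over every real `p ∉ 2πℤ⁴`, every `α`, for every fibre function
`g` whose six pairings `⟨b, g/|p+2π·|²⟩` converge. [cite: Federbush1986PhaseCellI, (3.5)–(3.6) p. 327] -/
theorem opD_opC {p : Fin 4 → ℝ} (hp : ∀ k (m : ℤ), p k ≠ 2 * Real.pi * m) (α : ℝ) (g : Fib)
    (hg : ∀ b, Summable fun n : Fin 4 → ℤ => ∑ ν, conj (Ptil b (shiftR p n) ν) * (g n ν / lam p n)) :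
    opD α p (opC α p g) = g := by
  funext n μ
  have hlam := lam_ne_zero hp n
  have hz : ∀ a, (α : ℂ) ^ 2 * cvec p g a - (kMat α p *ᵥ cvec p g) a
      - (α : ℂ) ^ 2 * (gramM p *ᵥ (kMat α p *ᵥ cvec p g)) a = 0 := by
    intro a
    have h := congr_fun (kMat_mulVec_add hp α (cvec p g)) a
    simp only [Pi.add_apply, Pi.smul_apply, smul_eq_mul] at h
    linear_combination -h
  simp only [opD]
  simp_rw [pairing_opC hp α g hg]
  rw [opC_apply]
  have hcomb : (α : ℂ) ^ 2 * ∑ a, Ptil a (shiftR p n) μ * (cvec p g a - (gramM p *ᵥ (kMat α p *ᵥ cvec p g)) a)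
      - ∑ a, Ptil a (shiftR p n) μ * (kMat α p *ᵥ cvec p g) a = 0 := by
    rw [Finset.mul_sum, ← Finset.sum_sub_distrib]
    refine Finset.sum_eq_zero fun a _ => ?_
    linear_combination (Ptil a (shiftR p n) μ) * hz a
  have h1 : lam p n * (g n μ / lam p n - 1 / lam p n * ∑ a, Ptil a (shiftR p n) μ * (kMat α p *ᵥ cvec p g) a)
      = g n μ - ∑ a, Ptil a (shiftR p n) μ * (kMat α p *ᵥ cvec p g) a := by
    field_simp
  rw [h1]
  linear_combination hcomb

/-- The pairings of `(Df)/|·|²`: `⟨b, Df/|·|²⟩ = d_b + α²(Md)_b` with `d = ⟨·, f⟩`. [cite: Federbush1986PhaseCellI, (3.5), (3.7) p. 327] -/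
theorem cvec_opD {p : Fin 4 → ℝ} (hp : ∀ k (m : ℤ), p k ≠ 2 * Real.pi * m) (α : ℝ) (f : Fib)
    (hf : ∀ a, Summable fun n : Fin 4 → ℤ => ∑ μ, conj (Ptil a (shiftR p n) μ) * f n μ) (b : Fin 6) :
    cvec p (opD α p f) b = dvec p f b + (α : ℂ) ^ 2 * (gramM p *ᵥ dvec p f) b := by
  have hsplit : ∀ n : Fin 4 → ℤ, ∑ ν, conj (Ptil b (shiftR p n) ν) * (opD α p f n ν / lam p n)
      = ∑ ν, conj (Ptil b (shiftR p n) ν) * f n ν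
        + ∑ a, (α : ℂ) ^ 2 * dvec p f a * ∑ ν, conj (Ptil b (shiftR p n) ν) * (Ptil a (shiftR p n) ν / lam p n) := by
    intro n
    have hlam := lam_ne_zero hp n
    have happ : ∀ ν, opD α p f n ν / lam p n
        = f n ν + ∑ a, (α : ℂ) ^ 2 * dvec p f a * (Ptil a (shiftR p n) ν / lam p n) := by
      intro ν
      rw [div_eq_iff hlam]
      simp only [opD, dvec]
      rw [add_mul, Finset.sum_mul, Finset.mul_sum]
      congr 1
      · ring
      · refine Finset.sum_congr rfl fun a _ => ?_
        rw [mul_assoc ((α : ℂ) ^ 2 * pairing p a f), div_mul_cancel₀ _ hlam]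
        ring
    simp_rw [happ, mul_add, Finset.sum_add_distrib]
    congr 1
    simp_rw [Finset.mul_sum]
    rw [Finset.sum_comm]
    refine Finset.sum_congr rfl fun a _ => Finset.sum_congr rfl fun ν _ => ?_
    ring
  unfold cvec pairing
  simp_rw [hsplit]
  rw [Summable.tsum_add (hf b) (summable_sum fun a _ => (summable_Ptil_term hp b a).mul_left _)]
  rw [Summable.tsum_finsetSum fun a _ => (summable_Ptil_term hp b a).mul_left _]
  simp_rw [tsum_mul_left]
  rw [mul_add, Finset.mul_sum]
  congr 1
  rw [Matrix.mulVec, dotProduct, Finset.mul_sum]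
  refine Finset.sum_congr rfl fun a _ => ?_
  rw [← pairing_Ptil_div_lam p b a, pairing, dvec]
  ring

/-- **«C = D⁻¹» (3.6), left inverse: `C(Df) = f`** on the fibre over every real `p ∉ 2πℤ⁴`, every `α`, for every fibre function
`f` whose six pairings `⟨a, f⟩` converge. [cite: Federbush1986PhaseCellI, (3.5)–(3.6) p. 327] -/
theorem opC_opD {p : Fin 4 → ℝ} (hp : ∀ k (m : ℤ), p k ≠ 2 * Real.pi * m) (α : ℝ) (f : Fib)
    (hf : ∀ a, Summable fun n : Fin 4 → ℤ => ∑ μ, conj (Ptil a (shiftR p n) μ) * f n μ) :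
    opC α p (opD α p f) = f := by
  funext n μ
  have hlam := lam_ne_zero hp n
  have hz : ∀ a, (α : ℂ) ^ 2 * dvec p f a - (kMat α p *ᵥ dvec p f) a
      - (α : ℂ) ^ 2 * (kMat α p *ᵥ (gramM p *ᵥ dvec p f)) a = 0 := by
    intro a
    have h := congr_fun (kMat_mulVec_add' hp α (dvec p f)) a
    simp only [Pi.add_apply, Pi.smul_apply, smul_eq_mul] at h
    linear_combination -h
  rw [opC_apply]
  have hc : cvec p (opD α p f) = dvec p f + ((α : ℂ) ^ 2) • (gramM p *ᵥ dvec p f) := by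
    funext b; rw [cvec_opD hp α f hf b]; simp
  rw [hc, Matrix.mulVec_add, Matrix.mulVec_smul]
  simp only [opD, Pi.add_apply, Pi.smul_apply, smul_eq_mul]
  have hcomb : (α : ℂ) ^ 2 * ∑ a, Ptil a (shiftR p n) μ * dvec p f a
      - ∑ a, Ptil a (shiftR p n) μ * ((kMat α p *ᵥ dvec p f) a
        + (α : ℂ) ^ 2 * (kMat α p *ᵥ (gramM p *ᵥ dvec p f)) a) = 0 := by
    rw [Finset.mul_sum, ← Finset.sum_sub_distrib]
    refine Finset.sum_eq_zero fun a _ => ?_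
    linear_combination (Ptil a (shiftR p n) μ) * hz a
  have hd : ∀ a, pairing p a f = dvec p f a := fun a => rfl
  simp_rw [hd]
  field_simp
  linear_combination hcomb

/-! ## (3.11) on the fibre -/

/-- The fibre of the source `Σ_γ β_γ χ_γ` of (3.11): `Σ_a β̂_a P̃_a(p + 2πn)`, for the lattice Fourier series
`β̂_a(p) = Σ_b e^{−ip·b} β_{⟨b,a⟩}` of the plaquette data. [cite: Federbush1986PhaseCellI, (3.11) p. 328] -/
def src (p : Fin 4 → ℝ) (βh : Fin 6 → ℂ) : Fib := fun n μ => ∑ a, βh a * Ptil a (shiftR p n) μ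

/-- `⟨b, α² src/|·|²⟩ = α²(Mβ̂)_b`. [cite: Federbush1986PhaseCellI, (3.7), (3.11) p. 327–328] -/
theorem cvec_src (p : Fin 4 → ℝ) {hp : ∀ k (m : ℤ), p k ≠ 2 * Real.pi * m} (α : ℝ) (βh : Fin 6 → ℂ) (b : Fin 6) :
    cvec p (fun n μ => (α : ℂ) ^ 2 * src p βh n μ) b = (α : ℂ) ^ 2 * (gramM p *ᵥ βh) b := by
  have hsplit : ∀ n : Fin 4 → ℤ, ∑ ν, conj (Ptil b (shiftR p n) ν) * ((α : ℂ) ^ 2 * src p βh n ν / lam p n)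
      = ∑ a, (α : ℂ) ^ 2 * βh a * ∑ ν, conj (Ptil b (shiftR p n) ν) * (Ptil a (shiftR p n) ν / lam p n) := by
    intro n
    simp only [src]
    simp_rw [Finset.mul_sum, Finset.sum_div, Finset.mul_sum]
    rw [Finset.sum_comm]
    refine Finset.sum_congr rfl fun a _ => Finset.sum_congr rfl fun ν _ => ?_
    ring
  unfold cvec pairing
  simp_rw [hsplit]
  rw [Summable.tsum_finsetSum fun a _ => (summable_Ptil_term hp b a).mul_left _]
  simp_rw [tsum_mul_left]
  rw [Finset.mul_sum, Matrix.mulVec, dotProduct, Finset.mul_sum]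
  refine Finset.sum_congr rfl fun a _ => ?_
  rw [← pairing_Ptil_div_lam p b a, pairing]
  ring

/-- **(3.11) «A′ = α²C Σ_γ β_γχ_γ» on the fibre, computed with (3.6)**:
`(α² C src)(n)_μ = (1/|p+2πn|²) Σ_a P̃_a(p+2πn)_μ [α²(1 + α²M(p))⁻¹ β̂]_a`. [cite: Federbush1986PhaseCellI, (3.11), (3.6) p. 327–328] -/
theorem opC_src {p : Fin 4 → ℝ} (hp : ∀ k (m : ℤ), p k ≠ 2 * Real.pi * m) (α : ℝ) (βh : Fin 6 → ℂ)
    (n : Fin 4 → ℤ) (μ : Fin 4) :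
    opC α p (fun n μ => (α : ℂ) ^ 2 * src p βh n μ) n μ
      = (1 / lam p n) * ∑ a, Ptil a (shiftR p n) μ * (kMat α p *ᵥ βh) a := by
  have hlam := lam_ne_zero hp n
  have hz : ∀ a, (α : ℂ) ^ 2 * βh a - (α : ℂ) ^ 2 * (kMat α p *ᵥ (gramM p *ᵥ βh)) a = (kMat α p *ᵥ βh) a := by
    intro a
    have h := congr_fun (kMat_mulVec_add' hp α βh) a
    simp only [Pi.add_apply, Pi.smul_apply, smul_eq_mul] at h
    linear_combination -h
  rw [opC_apply]
  have hc : cvec p (fun n μ => (α : ℂ) ^ 2 * src p βh n μ) = ((α : ℂ) ^ 2) • (gramM p *ᵥ βh) := by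
    funext b; rw [cvec_src p (hp := hp) α βh b]; simp
  have key : (α : ℂ) ^ 2 * src p βh n μ
      - ∑ a, Ptil a (shiftR p n) μ * ((α : ℂ) ^ 2 * (kMat α p *ᵥ (gramM p *ᵥ βh)) a)
      = ∑ a, Ptil a (shiftR p n) μ * (kMat α p *ᵥ βh) a := by
    simp only [src]
    rw [Finset.mul_sum, ← Finset.sum_sub_distrib]
    refine Finset.sum_congr rfl fun a _ => ?_
    rw [← hz a]
    ring
  rw [hc, Matrix.mulVec_smul]
  simp only [Pi.smul_apply, smul_eq_mul]
  rw [← key]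
  ring

/-- At the base point `n = 0` of the fibre, (3.11) computed with (3.6) is print's finite-`α` form of (3.12):
`(1/p²) Σ_a P̃_{i,a}(p) [α²(1 + α²M(p))⁻¹ β̂]_a` (the expression of `tendsto_landau312_unitBond_alpha`).
[cite: Federbush1986PhaseCellI, (3.11)–(3.12) p. 328] -/
theorem opC_src_zero {p : Fin 4 → ℝ} (hp : ∀ k (m : ℤ), p k ≠ 2 * Real.pi * m) (α : ℝ) (βh : Fin 6 → ℂ) (i : Fin 4) :
    opC α p (fun n μ => (α : ℂ) ^ 2 * src p βh n μ) 0 i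
      = (1 / csq (toC p)) * ∑ a, ((1 / (2 * Real.pi) ^ 2 : ℂ) * fourierFactor (axisPair a).1 (axisPair a).2 p i) *
          (((α : ℂ) ^ 2) • ((1 + ((α : ℂ) ^ 2) • gramM p)⁻¹ *ᵥ βh)) a := by
  rw [opC_src hp, lam, shiftR_zero, kMat, Matrix.smul_mulVec]
  rfl

/-- **(3.11) → (3.12) «Taking the limit α → ∞»** for the unit bond, now starting from the OPERATOR form (3.11) = `α² C src`
computed through (3.6): the base-point value tends to [F-II] (2.1) `Aprime` (the tree's `tendsto_landau312_unitBond_alpha`).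
[cite: Federbush1986PhaseCellI, (3.11)–(3.12) p. 328; FederbushWilliamson1987PhaseCellII, (2.1) p. 1417] -/
theorem tendsto_opC_src_unitBond {p : Fin 4 → ℝ} (hp : ∀ k (m : ℤ), p k ≠ 2 * Real.pi * m) (i : Fin 4) :
    Tendsto (fun α : ℝ => opC α p (fun n μ => (α : ℂ) ^ 2 * src p (unitPlaqFourier p) n μ) 0 i) atTop
      (𝓝 (Aprime i (toC p))) := by
  simp_rw [opC_src_zero hp]
  exact tendsto_landau312_unitBond_alpha hp i

/-! ## (3.4) on the fibre and its Euler–Lagrange equation (3.11) -/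

/-- **(3.4) on the fibre over `p`**: `S_p[f] = ½ Σ_n |p+2πn|²|f(n)|² + ½ α² (2π)⁻⁴ Σ_a |⟨a, f⟩ − β̂_a|²` (Plancherel for
`½∫Σ(∂A′_i/∂x_j)²`, Parseval over the corners `b ∈ ℤ⁴` for `½α²Σ_p((χ_p, A′) − β_p)²`). [cite: Federbush1986PhaseCellI, (3.4) p. 327] -/
def penS (α : ℝ) (p : Fin 4 → ℝ) (βh : Fin 6 → ℂ) (f : Fib) : ℝ :=
  (1 / 2) * ∑' n, lamR p n * ∑ μ, Complex.normSq (f n μ)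
    + (1 / 2) * α ^ 2 * (1 / (2 * Real.pi) ^ 4) * ∑ a, Complex.normSq (pairing p a f - βh a)

/-- The one-site perturbation `f + z·δ_{n₀,μ₀}` of a fibre function. [cite: Federbush1986PhaseCellI, (3.4) p. 327] -/
def bump (f : Fib) (n₀ : Fin 4 → ℤ) (μ₀ : Fin 4) (z : ℂ) : Fib := fun n μ =>
  f n μ + if n = n₀ ∧ μ = μ₀ then z else 0

/-- [folklore] -/
private theorem conj_twoPi_pow_four : conj ((2 * Real.pi : ℂ) ^ 4) = (2 * Real.pi : ℂ) ^ 4 := by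
  have : ((2 * Real.pi : ℂ) ^ 4) = (((2 * Real.pi) ^ 4 : ℝ) : ℂ) := by push_cast; rfl
  rw [this, Complex.conj_ofReal]

/-- [folklore] -/
private theorem twoPi_pow_four_eq : ((2 * Real.pi : ℂ) ^ 4) = (((2 * Real.pi) ^ 4 : ℝ) : ℂ) := by push_cast; rfl

/-- `⟨a, f + zδ_{n₀,μ₀}⟩ = ⟨a, f⟩ + (2π)⁴ P̄̃_a(p+2πn₀)_{μ₀} z`. [cite: Federbush1986PhaseCellI, (3.4) p. 327] -/
theorem pairing_bump {p : Fin 4 → ℝ} (f : Fib) (n₀ : Fin 4 → ℤ) (μ₀ : Fin 4) (z : ℂ) {a : Fin 6}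
    (hf : Summable fun n : Fin 4 → ℤ => ∑ μ, conj (Ptil a (shiftR p n) μ) * f n μ) :
    pairing p a (bump f n₀ μ₀ z) = pairing p a f + (2 * Real.pi : ℂ) ^ 4 * conj (Ptil a (shiftR p n₀) μ₀) * z := by
  have hsplit : ∀ n : Fin 4 → ℤ, ∑ μ, conj (Ptil a (shiftR p n) μ) * bump f n₀ μ₀ z n μ
      = ∑ μ, conj (Ptil a (shiftR p n) μ) * f n μ + (if n = n₀ then conj (Ptil a (shiftR p n₀) μ₀) * z else 0) := by
    intro n
    simp only [bump, mul_add, Finset.sum_add_distrib]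
    congr 1
    by_cases hn : n = n₀
    · subst hn; simp
    · simp [hn]
  unfold pairing
  simp_rw [hsplit]
  rw [Summable.tsum_add hf (summable_of_ne_finset_zero (s := {n₀}) (by intro n hn; simp at hn; simp [hn])), tsum_ite_eq]
  ring

/-- The kinetic series of `f + zδ_{n₀,μ₀}`. [cite: Federbush1986PhaseCellI, (3.4) p. 327] -/
theorem tsum_lamR_bump {p : Fin 4 → ℝ} (f : Fib) (n₀ : Fin 4 → ℤ) (μ₀ : Fin 4) (z : ℂ)
    (hlam : Summable fun n : Fin 4 → ℤ => lamR p n * ∑ μ, Complex.normSq (f n μ)) :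
    ∑' n, lamR p n * ∑ μ, Complex.normSq (bump f n₀ μ₀ z n μ)
      = ∑' n, lamR p n * ∑ μ, Complex.normSq (f n μ)
        + lamR p n₀ * (Complex.normSq (f n₀ μ₀ + z) - Complex.normSq (f n₀ μ₀)) := by
  have hsplit : ∀ n : Fin 4 → ℤ, lamR p n * ∑ μ, Complex.normSq (bump f n₀ μ₀ z n μ)
      = lamR p n * ∑ μ, Complex.normSq (f n μ)
        + (if n = n₀ then lamR p n₀ * (Complex.normSq (f n₀ μ₀ + z) - Complex.normSq (f n₀ μ₀)) else 0) := by
    intro n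
    by_cases hn : n = n₀
    · subst hn
      simp only [bump, true_and, if_true]
      have : ∀ μ, Complex.normSq (f n μ + if μ = μ₀ then z else 0)
          = Complex.normSq (f n μ) + (if μ = μ₀ then Complex.normSq (f n μ₀ + z) - Complex.normSq (f n μ₀) else 0) := by
        intro μ
        by_cases hμ : μ = μ₀
        · subst hμ; simp
        · simp [hμ]
      simp_rw [this, Finset.sum_add_distrib, Finset.sum_ite_eq' Finset.univ μ₀, Finset.mem_univ, if_true]
      ring
    · simp [bump, hn]
  simp_rw [hsplit]
  rw [Summable.tsum_add hlam (summable_of_ne_finset_zero (s := {n₀}) (by intro n hn; simp at hn; simp [hn])), tsum_ite_eq]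

/-- A complex number `W` with `re(W z̄) + Q|z|² ≥ 0` for all `z` (some `Q ≥ 0`) vanishes. [folklore] -/
private theorem eq_zero_of_forall_re_add_normSq_nonneg {W : ℂ} {Q : ℝ} (hQ : 0 ≤ Q)
    (h : ∀ z : ℂ, 0 ≤ (W * conj z).re + Q * Complex.normSq z) : W = 0 := by
  by_contra hW
  have hns : 0 < Complex.normSq W := Complex.normSq_pos.mpr hW
  set t : ℝ := 1 / (Q + 1) with ht
  have htpos : 0 < t := by rw [ht]; positivity
  have key := h (-(t : ℂ) * W)
  have h1 : (W * conj (-(t : ℂ) * W)).re = -t * Complex.normSq W := by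
    rw [map_mul, map_neg, Complex.conj_ofReal, show W * (-(t : ℂ) * conj W) = -(t : ℂ) * (W * conj W) by ring,
      Complex.mul_conj]
    simp
  have h2 : Complex.normSq (-(t : ℂ) * W) = t ^ 2 * Complex.normSq W := by
    rw [Complex.normSq_mul, Complex.normSq_neg, Complex.normSq_ofReal]; ring
  rw [h1, h2] at key
  have h3 : Q * t < 1 := by
    rw [ht, mul_one_div, div_lt_one (by linarith)]; linarith
  nlinarith [mul_pos htpos hns]

/-- **(3.4) ⇒ (3.11) on the fibre (Euler–Lagrange)**: a minimiser of `S_p` against every one-site perturbation satisfies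
`D f = α² src β̂`, i.e. `|p+2πn|² f(n) + α² Σ_a P̃_a(p+2πn) (⟨a, f⟩ − β̂_a) = 0` componentwise. [cite: Federbush1986PhaseCellI, (3.4), (3.11) p. 327–328] -/
theorem opD_eq_src_of_isMin {p : Fin 4 → ℝ} (α : ℝ) (βh : Fin 6 → ℂ) (f : Fib)
    (hf : ∀ a, Summable fun n : Fin 4 → ℤ => ∑ μ, conj (Ptil a (shiftR p n) μ) * f n μ)
    (hlam : Summable fun n : Fin 4 → ℤ => lamR p n * ∑ μ, Complex.normSq (f n μ))
    (hmin : ∀ n₀ μ₀ (z : ℂ), penS α p βh f ≤ penS α p βh (bump f n₀ μ₀ z)) :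
    opD α p f = fun n μ => (α : ℂ) ^ 2 * src p βh n μ := by
  funext n₀ μ₀
  -- abbreviations
  set P : Fin 6 → ℂ := fun a => Ptil a (shiftR p n₀) μ₀ with hP
  set c : Fin 6 → ℂ := fun a => pairing p a f - βh a with hc
  set L : ℝ := lamR p n₀ with hL
  set W : ℂ := (L : ℂ) * f n₀ μ₀ + (α : ℂ) ^ 2 * ∑ a, c a * P a with hW
  set Q : ℝ := (1 / 2) * L + (1 / 2) * α ^ 2 * (1 / (2 * Real.pi) ^ 4) *
    ∑ a, Complex.normSq ((2 * Real.pi : ℂ) ^ 4 * conj (P a)) with hQ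
  have hQnn : 0 ≤ Q := by
    have hL0 : 0 ≤ L := Finset.sum_nonneg fun k _ => sq_nonneg _
    have : 0 ≤ ∑ a, Complex.normSq ((2 * Real.pi : ℂ) ^ 4 * conj (P a)) :=
      Finset.sum_nonneg fun a _ => Complex.normSq_nonneg _
    rw [hQ]; positivity
  -- the variation of `S_p` along the one-site perturbation
  have hdiff : ∀ z : ℂ, penS α p βh (bump f n₀ μ₀ z) - penS α p βh f = (W * conj z).re + Q * Complex.normSq z := by
    intro z
    simp only [penS]
    rw [tsum_lamR_bump f n₀ μ₀ z hlam]
    simp_rw [pairing_bump f n₀ μ₀ z (hf _)]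
    have e1 : Complex.normSq (f n₀ μ₀ + z) - Complex.normSq (f n₀ μ₀)
        = Complex.normSq z + 2 * (f n₀ μ₀ * conj z).re := by
      rw [Complex.normSq_add]; ring
    have e2 : ∀ a, Complex.normSq (pairing p a f + (2 * Real.pi : ℂ) ^ 4 * conj (Ptil a (shiftR p n₀) μ₀) * z - βh a)
        = Complex.normSq (c a) + Complex.normSq ((2 * Real.pi : ℂ) ^ 4 * conj (P a)) * Complex.normSq z
          + 2 * (2 * Real.pi) ^ 4 * (c a * P a * conj z).re := by
      intro a
      rw [show pairing p a f + (2 * Real.pi : ℂ) ^ 4 * conj (Ptil a (shiftR p n₀) μ₀) * z - βh a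
          = c a + ((2 * Real.pi : ℂ) ^ 4 * conj (P a)) * z by simp only [hc, hP]; ring,
        Complex.normSq_add, Complex.normSq_mul]
      have : (c a * conj (((2 * Real.pi : ℂ) ^ 4 * conj (P a)) * z)).re = (2 * Real.pi) ^ 4 * (c a * P a * conj z).re := by
        rw [map_mul, map_mul, conj_twoPi_pow_four, Complex.conj_conj,
          show c a * ((2 * Real.pi : ℂ) ^ 4 * P a * conj z) = (2 * Real.pi : ℂ) ^ 4 * (c a * P a * conj z) by ring,
          twoPi_pow_four_eq, Complex.re_ofReal_mul]
      rw [this]; ring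
    simp_rw [e2]
    rw [e1, Finset.sum_add_distrib, Finset.sum_add_distrib]
    have e3 : (W * conj z).re = L * (f n₀ μ₀ * conj z).re + α ^ 2 * ∑ a, (c a * P a * conj z).re := by
      rw [hW, add_mul, Complex.add_re, show (L : ℂ) * f n₀ μ₀ * conj z = (L : ℂ) * (f n₀ μ₀ * conj z) by ring,
        Complex.re_ofReal_mul, show ((α : ℂ) ^ 2 * ∑ a, c a * P a) * conj z
          = ((α ^ 2 : ℝ) : ℂ) * ∑ a, c a * P a * conj z by push_cast; rw [mul_assoc, Finset.sum_mul],
        Complex.re_ofReal_mul, Complex.re_sum]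
    rw [e3, hQ]
    have hπ : ((2 * Real.pi) ^ 4 : ℝ) ≠ 0 := by positivity
    rw [← Finset.sum_mul, ← Finset.mul_sum]
    simp only [hc, hP]
    field_simp
    ring
  -- minimality forces the linear coefficient to vanish
  have hWz : W = 0 := by
    refine eq_zero_of_forall_re_add_normSq_nonneg hQnn fun z => ?_
    rw [← hdiff z]
    linarith [hmin n₀ μ₀ z]
  -- and `W = (D f − α² src)(n₀)_{μ₀}`
  have hWeq : W = opD α p f n₀ μ₀ - (α : ℂ) ^ 2 * src p βh n₀ μ₀ := by
    simp only [hW, hc, hP, hL, opD, src, lam_eq, Finset.mul_sum]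
    rw [add_sub_assoc, ← Finset.sum_sub_distrib]
    congr 1
    refine Finset.sum_congr rfl fun a _ => ?_
    ring
  rw [hWeq] at hWz
  exact sub_eq_zero.mp hWz

/-- **(3.4) ⇒ (3.11) «From (3.4) we see the minimizing A′ will satisfy A′ = α²C Σ_γ β_γχ_γ»**: such a minimiser IS `α² C src`
on the fibre (Euler–Lagrange + `C D = 1`). [cite: Federbush1986PhaseCellI, (3.4), (3.11) p. 327–328] -/
theorem eq_opC_src_of_isMin {p : Fin 4 → ℝ} (hp : ∀ k (m : ℤ), p k ≠ 2 * Real.pi * m) (α : ℝ) (βh : Fin 6 → ℂ)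
    (f : Fib) (hf : ∀ a, Summable fun n : Fin 4 → ℤ => ∑ μ, conj (Ptil a (shiftR p n) μ) * f n μ)
    (hlam : Summable fun n : Fin 4 → ℤ => lamR p n * ∑ μ, Complex.normSq (f n μ))
    (hmin : ∀ n₀ μ₀ (z : ℂ), penS α p βh f ≤ penS α p βh (bump f n₀ μ₀ z)) :
    f = opC α p (fun n μ => (α : ℂ) ^ 2 * src p βh n μ) := by
  rw [← opD_eq_src_of_isMin α βh f hf hlam hmin, opC_opD hp α f hf]

end PlaquetteGram

/-! ## (3.4) and (3.5) in position space — see the ERRATUM (v1.1) in the module docstring: the verbatim displays are `LandauPenaltyDictionary`'s `penaltyActionFix` / `opDPosFix` -/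

namespace LandauPenalty

/-- (3.4) «S = ½∫Σ_{i,j}(∂A′_i/∂x_j)² + ½α² Σ_{p∈ℒ⁰} ((χ_p, A′) − β_p)²» for a (Landau-gauge) vector field `A′` on `ℝ⁴`,
level-0 plaquette data `β` and penalty `α` (`(χ_p, A′)` = the tree's `plaqFunctional 0 A′ p`, cf.
`plaqFunctional_eq_integral_plaqTestField`; `∂A′_i/∂x_j = pd A′ j i`).  **ERRATUM (v1.1)**: this body PARSES as
`½ ∫ (Σ_{i,j}(∂_jA_i)² + ½α²Σ_q(…)²) d⁴x` (penalty INSIDE the integral; `LandauPenaltyDictionary.penaltyAction_eq`) and sums `q` over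
the TYPE `Plaq 0` (both orientations) — it is NOT print's `S`; the verbatim (3.4) is `LandauPenaltyDictionary`'s `penaltyActionFix`.
[cite: Federbush1986PhaseCellI, (3.4) p. 327] -/
def penaltyAction (α : ℝ) (β : Plaq 0 → ℝ) (A : E4 → Fin 4 → ℝ) : ℝ :=
  (1 / 2) * ∫ x, ∑ i, ∑ j, (pd A j i x) ^ 2 + (1 / 2) * α ^ 2 * ∑' q : Plaq 0, (plaqFunctional 0 A q - β q) ^ 2

/-- `S ≥ 0`. [cite: Federbush1986PhaseCellI, (3.4) p. 327] -/
theorem penaltyAction_nonneg (α : ℝ) (β : Plaq 0 → ℝ) (A : E4 → Fin 4 → ℝ) : 0 ≤ penaltyAction α β A := by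
  unfold penaltyAction
  have h1 : 0 ≤ ∫ x, ∑ i, ∑ j, (pd A j i x) ^ 2 :=
    MeasureTheory.integral_nonneg fun x => Finset.sum_nonneg fun i _ => Finset.sum_nonneg fun j _ => sq_nonneg _
  have h2 : 0 ≤ ∑' q : Plaq 0, (plaqFunctional 0 A q - β q) ^ 2 := tsum_nonneg fun q => sq_nonneg _
  positivity

/-- (3.5) «D = −Δ + α² Σ_γ χ_γχ_γ», «the sum over γ … over plaquettes in ℒ⁰», acting on a vector field:
`(DA)_μ(x) = −Σ_j ∂_j∂_j A_μ(x) + α² Σ_γ χ_γ(x)_μ (χ_γ, A)` (`tsum` over the TYPE `Plaq 0`).  **ERRATUM (v1.1)**: the type carries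
both orientations of every plaquette, so this is print's `D` at penalty `√2·α` (`LandauPenaltyDictionary.opDPos_eq_opDPosFix`); the
verbatim (3.5) (one fixed orientation, (3.9)) is `LandauPenaltyDictionary`'s `opDPosFix`. [cite: Federbush1986PhaseCellI, (3.5) p. 327] -/
def opDPos (α : ℝ) (A : E4 → Fin 4 → ℝ) (x : E4) (μ : Fin 4) : ℝ :=
  -(∑ j, pd (fun y ν => pd A j ν y) j μ x) + α ^ 2 * ∑' γ : Plaq 0, plaqTestField γ x μ * plaqFunctional 0 A γ

/-- At `α = 0`, `D = −Δ`. [cite: Federbush1986PhaseCellI, (3.5) p. 327] -/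
theorem opDPos_zero (A : E4 → Fin 4 → ℝ) (x : E4) (μ : Fin 4) :
    opDPos 0 A x μ = -(∑ j, pd (fun y ν => pd A j ν y) j μ x) := by
  simp [opDPos]

end LandauPenalty

end

end Literature.MathematicalPhysics.QuantumFieldTheory.Federbush1986
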